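import Summits.BirchSwinnertonDyer.BirchSwinnertonDyer.Theses.UniversalToricDescent
import Summits.BirchSwinnertonDyer.BirchSwinnertonDyer.Theorems.SchneiderFreeAdditiveX3PoitouTateShaDualityHolds
import Literature.NumberTheory.EllipticCurves.Hsieh2014.AnticyclotomicPAdicLFunctionAnyLevel
import Literature.NumberTheory.EllipticCurves.LiuZhangZhang2018.PAdicWaldspurgerEllipticCurveAdditive
import Literature.NumberTheory.EllipticCurves.ComplexMultiplication
import HarnessLib

set_option linter.dupNamespace false -- `…BirchSwinnertonDyer.BirchSwinnertonDyer…` is the cell's nested layout (D-0017)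
set_option autoImplicit false

/-!
# Crux 20372 `PrintCFram.BottomClassIndexLawFiveLe` (route `PrintCFram`, rev 21), skeleton of record v7
# `Cruxes/BottomClassIndexLawFiveLe/Lines/eisenstein_resource_bdp_line.lean` (sha16 ec9c97a3778f7d32, LEAD cfram-p1 g6 13:17:29Z):
# `stub_prints` — SEVEN named facts — from FOUR printed inputs
# (LADDER-BSD D-0154 (2) INPUTS, desk `pub/bsd-wall/bsd-inputs`, INPUTS-LIST-2 row 12 CFram; tranche entry T22 of ADDENDUM-16 §Z)

`--supports stmt-BirchSwinnertonDyer-20372` (helper mode).  Of the seven conjuncts of v7's `stub_prints`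
(Hsieh 2014 Thm. A any level · Liu–Zhang–Zhang 2018 Thm 1.5.1/1.5.3 · route UTD's `ToricPublishedInputs` · Poitou–Tate duality for Ш ∀ K ·
Burungale–Flach 2024 Cor. 2 (`bsdTriple_of_hasCM_of_L_one_ne_zero`, INPUTS-LIST-2 F36) · modularity (`hasEntireLFunction_rat`, F3) ·
Cassels 1965 (`bsdRHS_eq_of_isIsogenous`, F71)) THREE are redundant GIVEN the other four:
* conjunct 4 (`∀ K, poitouTate_sha_tateDual K`) is a THEOREM of the tree —
  `SchneiderFreeAdditiveX3.PoitouTateReduction.poitouTate_sha_tateDual_holds` (Theorems/SchneiderFreeAdditiveX3PoitouTateShaDualityHolds.lean:47,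
  door-c4 g19 11:44Z; the same discharge as `PrintCf2.EisensteinTwo.poitouTate_sha_tateDual_forall`, p635518);
* conjunct 6 (F3) is conjunct 4 of `ToricPublishedInputs` (Theses/UniversalToricDescent.lean:1047) and conjunct 7 (F71) is its conjunct 6 — projections.
After this file the displayed printed inputs of `stub_prints` are FOUR named facts (Hsieh Thm. A = plan-1 INPUTS-LIST-1 / UTD item 20456
`HsiehAnyLevelInput`; LZZ = UTD item 20316; `ToricPublishedInputs` = UTD item 20389; F36), was seven; the lead (bsd-line-cfram-p1) may re-cut
`stub_prints` to the four-conjunct form at the next reshape and feed `prints7_of_four` (or keep seven and cite this file). Closes no item; changes no `closes`.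

Honest framing: CONDITIONAL on the four prints as typed; pure glue (two projections and one by-name theorem); no crux of substance and no
summit statement is proved; the Birch–Swinnerton-Dyer conjecture is NOT proved by any of this.
References: [Hsieh2014] Thm. A p. 712 (Doc. Math. 19); [LiuZhangZhang2018] Thm 1.5.1, Thm 1.5.3 (Duke Math. J. 167 pp. 748–749);
[BurungaleFlach2024] Thm. 1.1, Cor. 2; [MilneADT2006] Ch. I Thm. 4.10, Thm. 6.13; [BCDTJAMS2001] Thm. A; [Cassels1965ArithmeticVIII].
-/

namespace Summit.BirchSwinnertonDyer.BirchSwinnertonDyer.Theorems.PrintCFram.InputsPrints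

open WeierstrassCurve Literature.NumberTheory.EllipticCurves Literature.NumberTheory.GaloisCohomology
  Summit.BirchSwinnertonDyer.BirchSwinnertonDyer.Theses.UniversalToricDescent
  Summit.BirchSwinnertonDyer.BirchSwinnertonDyer.Theorems

/-- Modularity (entire continuation of `L(E/ℚ,s)`, F3) is conjunct 4 of route UTD's `ToricPublishedInputs`. [cite: BCDTJAMS2001, Thm. A] -/
theorem hasEntireLFunction_rat_of_toric (hT : ToricPublishedInputs) : hasEntireLFunction_rat :=
  hT.2.2.2.1

/-- Isogeny invariance of the BSD quotient (Cassels 1965, F71) is conjunct 6 of route UTD's `ToricPublishedInputs`.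
[cite: Cassels1965ArithmeticVIII] [cite: MilneADT2006, Thm. I.7.3] -/
theorem bsdRHS_eq_of_isIsogenous_of_toric (hT : ToricPublishedInputs) : bsdRHS_eq_of_isIsogenous :=
  hT.2.2.2.2.2.1

/-- **v7's `stub_prints` (seven conjuncts, VERBATIM) ⟸ FOUR printed inputs (Hsieh 2014 Thm. A any level · LZZ 2018 · `ToricPublishedInputs` ·
Burungale–Flach 2024 Cor. 2).**  Conjunct 4 (Poitou–Tate duality `Ш¹(K, M^D)` vs `Ш²(K, M)` for every number field, in the stub's
binder shape) is the tree theorem `SchneiderFreeAdditiveX3.PoitouTateReduction.poitouTate_sha_tateDual_holds` applied pointwise (the same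
`∀`-wrapper is landed as `PrintCf2.EisensteinTwo.poitouTate_sha_tateDual_forall`, p635518; it is inlined here so that this helper does not
import the Cf2 line's module).  CONDITIONAL; closes nothing; BSD is not proved.
[cite: Hsieh2014, Thm. A p. 712] [cite: LiuZhangZhang2018, Thm 1.5.1 and Thm 1.5.3] [cite: BurungaleFlach2024, Thm. 1.1 and Cor. 2]
[cite: MilneADT2006, Ch. I Thm. 4.10] -/
theorem prints7_of_four
    (hA : Hsieh2014.thmA_exists_isHsiehLFunction_unrPeriod_anyLevel)
    (hL : LiuZhangZhang2018.thm151_thm153_modularCurve_heegnerVector_additive)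
    (hT : ToricPublishedInputs)
    (hBF : bsdTriple_of_hasCM_of_L_one_ne_zero) :
    Hsieh2014.thmA_exists_isHsiehLFunction_unrPeriod_anyLevel ∧
    LiuZhangZhang2018.thm151_thm153_modularCurve_heegnerVector_additive ∧
    ToricPublishedInputs ∧
    (∀ (K : Type) [Field K] [NumberField K], poitouTate_sha_tateDual K) ∧
    bsdTriple_of_hasCM_of_L_one_ne_zero ∧
    hasEntireLFunction_rat ∧
    bsdRHS_eq_of_isIsogenous :=
  ⟨hA, hL, hT, fun K _ _ ↦ SchneiderFreeAdditiveX3.PoitouTateReduction.poitouTate_sha_tateDual_holds K, hBF,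
    hasEntireLFunction_rat_of_toric hT, bsdRHS_eq_of_isIsogenous_of_toric hT⟩

/-- Bundled form: the four prints as ONE conjunction (the shape a re-cut `stub_prints` would have) ⟹ v7's seven-conjunct `stub_prints`. -/
theorem prints7_of_prints4
    (h4 : Hsieh2014.thmA_exists_isHsiehLFunction_unrPeriod_anyLevel ∧
      LiuZhangZhang2018.thm151_thm153_modularCurve_heegnerVector_additive ∧
      ToricPublishedInputs ∧
      bsdTriple_of_hasCM_of_L_one_ne_zero) :
    Hsieh2014.thmA_exists_isHsiehLFunction_unrPeriod_anyLevel ∧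
    LiuZhangZhang2018.thm151_thm153_modularCurve_heegnerVector_additive ∧
    ToricPublishedInputs ∧
    (∀ (K : Type) [Field K] [NumberField K], poitouTate_sha_tateDual K) ∧
    bsdTriple_of_hasCM_of_L_one_ne_zero ∧
    hasEntireLFunction_rat ∧
    bsdRHS_eq_of_isIsogenous :=
  prints7_of_four h4.1 h4.2.1 h4.2.2.1 h4.2.2.2

end Summit.BirchSwinnertonDyer.BirchSwinnertonDyer.Theorems.PrintCFram.InputsPrints
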